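import Mathlib
import Summits.Ventures.HodgeRepro2.T5EquivariantDescent

/-!
# T5EquivariantWedge — the «forms ↔ functions» dictionary of N1 ID-4(a), second half

Blind cell `pub-hodge-repro2`, Tier-5 support for sub-step N1 (route/T5-ID-p2.md, Theorem ID(iv)):
«… the wedge of two holomorphic 1-forms is the pointwise exterior product
F ∧ F′ : Γ\G → ∧²(𝔭⁺)^* …», and the scalar functions on `S_j = Γ_j\G/K`.

Continues `T5EquivariantDescent.lean` (whose `descend`, `IsLeftInvariant`, `IsRightEquivariant`,
`rmul` are used):

* §4 pointwise bilinear products (the wedge) descend pointwise and stay equivariant when the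
  bilinear map is `K`-equivariant (`pointwise`, `descend_pointwise`,
  `isRightEquivariant_pointwise`), and are bilinear in the two functions;
* §5 trivial coefficients: left-`Γ`- and right-`K`-invariant functions are the functions on the
  double coset space `Γ\G/K` (`descendDCEquiv`, Mathlib's `DoubleCoset.Quotient`) — the
  scalar-function side of «S = ⊔_j Γ_j\G/K» (B2 (B2-iii)).

What stays prose: the differential geometry of Borel–Wallach's isomorphism (see the first file).
-/

namespace Summit.Ventures.HodgeRepro2.T5EquivariantWedge

open QuotientGroup Summit.Ventures.HodgeRepro2.T5EquivariantDescent

section Pointwise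

variable {G : Type*} [Group G] {Γ K : Subgroup G}
variable {R : Type*} [CommSemiring R]
variable {V V' V'' : Type*} [AddCommMonoid V] [Module R V] [AddCommMonoid V'] [Module R V']
  [AddCommMonoid V''] [Module R V'']

/-- The pointwise product of two `V`-, `V'`-valued functions through a bilinear map `B`
(for `B = ∧ : (𝔭⁺)^* × (𝔭⁺)^* → ∧²(𝔭⁺)^*`: the wedge of two 1-forms as functions on `G`). -/
def pointwise (B : V →ₗ[R] V' →ₗ[R] V'') (f : G → V) (f' : G → V') : G → V'' :=
  fun g => B (f g) (f' g)

omit [Group G] in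
/-- Evaluation of the pointwise product. -/
@[simp] theorem pointwise_apply (B : V →ₗ[R] V' →ₗ[R] V'') (f : G → V) (f' : G → V') (g : G) :
    pointwise B f f' g = B (f g) (f' g) := rfl

/-- The same on `Γ\G`. -/
def pointwiseQuot (B : V →ₗ[R] V' →ₗ[R] V'') (F : RightQuot Γ → V) (F' : RightQuot Γ → V') :
    RightQuot Γ → V'' :=
  fun x => B (F x) (F' x)

/-- Evaluation of the pointwise product on `Γ\G`. -/
@[simp] theorem pointwiseQuot_apply (B : V →ₗ[R] V' →ₗ[R] V'') (F : RightQuot Γ → V)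
    (F' : RightQuot Γ → V') (x : RightQuot Γ) : pointwiseQuot B F F' x = B (F x) (F' x) := rfl

/-- A pointwise product of left-invariant functions is left-invariant. -/
theorem isLeftInvariant_pointwise (B : V →ₗ[R] V' →ₗ[R] V'') {f : G → V} {f' : G → V'}
    (hf : IsLeftInvariant Γ f) (hf' : IsLeftInvariant Γ f') :
    IsLeftInvariant Γ (pointwise B f f') := by
  intro γ hγ g
  simp only [pointwise_apply, hf γ hγ g, hf' γ hγ g]

/-- **The wedge descends pointwise**: the descent of the pointwise product is the pointwise product
of the descents. -/
theorem descend_pointwise (B : V →ₗ[R] V' →ₗ[R] V'') {f : G → V} {f' : G → V'}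
    (hf : IsLeftInvariant Γ f) (hf' : IsLeftInvariant Γ f') :
    descend Γ (pointwise B f f') (isLeftInvariant_pointwise B hf hf') =
      pointwiseQuot B (descend Γ f hf) (descend Γ f' hf') := by
  funext x
  induction x using Quotient.inductionOn' with
  | h g => rfl

/-- A bilinear map `B` is `K`-equivariant for `(ρ, ρ', ρ'')` if `B (ρ k v) (ρ' k v') = ρ'' k (B v v')`
(for the wedge: `∧²` of the coadjoint action). -/
def IsEquivariantBilinear (ρ : Representation R K V) (ρ' : Representation R K V')
    (ρ'' : Representation R K V'') (B : V →ₗ[R] V' →ₗ[R] V'') : Prop :=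
  ∀ (k : K) (v : V) (v' : V'), B (ρ k v) (ρ' k v') = ρ'' k (B v v')

/-- **The wedge of two equivariant functions is equivariant** (for the induced coefficient
representation): `(F ∧ F′)(g k) = ρ'' k⁻¹ ((F ∧ F′) g)`. -/
theorem isRightEquivariant_pointwise {ρ : Representation R K V} {ρ' : Representation R K V'}
    {ρ'' : Representation R K V''} {B : V →ₗ[R] V' →ₗ[R] V''}
    (hB : IsEquivariantBilinear ρ ρ' ρ'' B) {f : G → V} {f' : G → V'}
    (hf : IsRightEquivariant K ρ f) (hf' : IsRightEquivariant K ρ' f') :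
    IsRightEquivariant K ρ'' (pointwise B f f') := by
  intro g k
  simp only [pointwise_apply, hf g k, hf' g k, hB k⁻¹]

/-- The same for functions on `Γ\G`. -/
theorem isRightEquivariantQuot_pointwiseQuot {ρ : Representation R K V}
    {ρ' : Representation R K V'} {ρ'' : Representation R K V''} {B : V →ₗ[R] V' →ₗ[R] V''}
    (hB : IsEquivariantBilinear ρ ρ' ρ'' B) {F : RightQuot Γ → V} {F' : RightQuot Γ → V'}
    (hF : IsRightEquivariantQuot Γ K ρ F) (hF' : IsRightEquivariantQuot Γ K ρ' F') :
    IsRightEquivariantQuot Γ K ρ'' (pointwiseQuot B F F') := by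
  intro x k
  simp only [pointwiseQuot_apply, hF x k, hF' x k, hB k⁻¹]

omit [Group G] in
/-- The pointwise product is bilinear in the two functions (for the descent of the Hodge pairing:
the wedge is ℂ-bilinear in the two 1-forms). -/
theorem pointwise_add_left (B : V →ₗ[R] V' →ₗ[R] V'') (f₁ f₂ : G → V) (f' : G → V') :
    pointwise B (f₁ + f₂) f' = pointwise B f₁ f' + pointwise B f₂ f' := by
  funext g; simp [pointwise]

omit [Group G] in
/-- The pointwise product is additive in the second function. -/
theorem pointwise_add_right (B : V →ₗ[R] V' →ₗ[R] V'') (f : G → V) (f₁' f₂' : G → V') :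
    pointwise B f (f₁' + f₂') = pointwise B f f₁' + pointwise B f f₂' := by
  funext g; simp [pointwise]

omit [Group G] in
/-- The pointwise product is homogeneous in the first function. -/
theorem pointwise_smul_left (B : V →ₗ[R] V' →ₗ[R] V'') (r : R) (f : G → V) (f' : G → V') :
    pointwise B (r • f) f' = r • pointwise B f f' := by
  funext g; simp [pointwise]

omit [Group G] in
/-- The pointwise product is homogeneous in the second function. -/
theorem pointwise_smul_right (B : V →ₗ[R] V' →ₗ[R] V'') (r : R) (f : G → V) (f' : G → V') :
    pointwise B f (r • f') = r • pointwise B f f' := by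
  funext g; simp [pointwise]

end Pointwise

section TrivialCoefficients

variable {G : Type*} [Group G] (Γ K : Subgroup G)
variable (R : Type*) [CommSemiring R] {V : Type*} [AddCommMonoid V] [Module R V]

/-- For the trivial coefficient representation, right-`K`-equivariance is right-`K`-invariance. -/
theorem isRightEquivariant_trivial_iff {f : G → V} :
    IsRightEquivariant K (Representation.trivial R K V) f ↔ ∀ (g : G) (k : K), f (g * k) = f g := by
  simp [IsRightEquivariant]

/-- The double coset space `Γ\G/K` (Mathlib's `DoubleCoset.Quotient`). -/
abbrev DCQuot : Type _ := DoubleCoset.Quotient (Γ : Set G) K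

variable {Γ K R}

omit [AddCommMonoid V] in
/-- A function that is left-`Γ`-invariant and right-`K`-invariant is constant on double cosets. -/
theorem eq_of_doubleCoset_rel {f : G → V} (hf : IsLeftInvariant Γ f)
    (hK : ∀ (g : G) (k : K), f (g * k) = f g) {a b : G} (hab : ∃ h ∈ Γ, ∃ k ∈ K, b = h * a * k) :
    f a = f b := by
  obtain ⟨h, hh, k, hk, rfl⟩ := hab
  rw [hK (h * a) ⟨k, hk⟩, hf h hh a]

variable (Γ K) in
/-- The descent of a left-`Γ`-, right-`K`-invariant function to the double coset space `Γ\G/K`. -/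
def descendDC (f : G → V) (hf : IsLeftInvariant Γ f) (hK : ∀ (g : G) (k : K), f (g * k) = f g) :
    DCQuot Γ K → V :=
  fun x => Quotient.liftOn' x f (fun _ _ hab => eq_of_doubleCoset_rel hf hK (DoubleCoset.rel_iff.1 hab))

omit [AddCommMonoid V] in
/-- The double-coset descent evaluated at the class of `g` is `f g`. -/
@[simp] theorem descendDC_mk {f : G → V} (hf : IsLeftInvariant Γ f)
    (hK : ∀ (g : G) (k : K), f (g * k) = f g) (g : G) :
    descendDC Γ K f hf hK (DoubleCoset.mk Γ K g) = f g := rfl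

omit [AddCommMonoid V] in
variable (Γ K) in
/-- Pull-backs of functions on `Γ\G/K` are left-`Γ`-invariant … -/
theorem isLeftInvariant_comp_dcmk (F : DCQuot Γ K → V) :
    IsLeftInvariant Γ (F ∘ DoubleCoset.mk Γ K) := by
  intro γ hγ g
  simp only [Function.comp_apply]
  congr 1
  rw [DoubleCoset.eq]
  exact ⟨γ⁻¹, Γ.inv_mem hγ, 1, K.one_mem, by group⟩

omit [AddCommMonoid V] in
variable (Γ K) in
/-- … and right-`K`-invariant. -/
theorem comp_dcmk_mul (F : DCQuot Γ K → V) (g : G) (k : K) :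
    (F ∘ DoubleCoset.mk Γ K) (g * k) = (F ∘ DoubleCoset.mk Γ K) g := by
  simp only [Function.comp_apply]
  congr 1
  rw [DoubleCoset.eq]
  exact ⟨1, Γ.one_mem, k⁻¹, K.inv_mem k.2, by group⟩

variable (Γ K R V) in
/-- The left-`Γ`-invariant, right-`K`-invariant functions (trivial coefficients) as a submodule. -/
def biInvariant : Submodule R (G → V) :=
  (leftInvariant Γ R : Submodule R (G → V)) ⊓ rightEquivariant K (Representation.trivial R K V)

/-- Membership in `biInvariant`: left-`Γ`-invariance and right-`K`-invariance. -/
theorem mem_biInvariant {f : G → V} :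
    f ∈ biInvariant Γ K R V ↔ IsLeftInvariant Γ f ∧ ∀ (g : G) (k : K), f (g * k) = f g := by
  simp only [biInvariant, Submodule.mem_inf, mem_leftInvariant, mem_rightEquivariant,
    isRightEquivariant_trivial_iff]

variable (Γ K R V) in
/-- **Scalar functions on `Γ\G/K`**: the bi-invariant functions on `G` are exactly the functions on
the double coset space `Γ\G/K` — the function side of «S_j = Γ_j\G/K_∞» (B2 (B2-iii)). -/
def descendDCEquiv : biInvariant Γ K R V ≃ₗ[R] (DCQuot Γ K → V) where
  toFun f := descendDC Γ K f.1 (mem_biInvariant.1 f.2).1 (mem_biInvariant.1 f.2).2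
  invFun F := ⟨F ∘ DoubleCoset.mk Γ K,
    mem_biInvariant.2 ⟨isLeftInvariant_comp_dcmk Γ K F, comp_dcmk_mul Γ K F⟩⟩
  left_inv f := by
    apply Subtype.ext
    rfl
  right_inv F := by
    funext x
    induction x using Quotient.inductionOn' with
    | h g => rfl
  map_add' f f' := by
    funext x
    induction x using Quotient.inductionOn' with
    | h g => rfl
  map_smul' r f := by
    funext x
    induction x using Quotient.inductionOn' with
    | h g => rfl

/-- The inverse map of `descendDCEquiv` is the pull-back along `DoubleCoset.mk`. -/
@[simp] theorem descendDCEquiv_symm_apply_coe (F : DCQuot Γ K → V) :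
    ((descendDCEquiv Γ K R V).symm F : G → V) = F ∘ DoubleCoset.mk Γ K := rfl

end TrivialCoefficients

end Summit.Ventures.HodgeRepro2.T5EquivariantWedge
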